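import Mathlib
import HarnessLib

/-!
# Compact operators upgrade strong convergence of contractions to norm convergence

Stub `stub_compactTruncationNorm` (S2) of the line `work-lipschitz-cycles` of the crux
`Summit.AnomalousDissipation.AnomalousDissipation.Theses.WazewskiBlock.UniformWorkFloorTrap`
(Galerkin persistence of a nondegenerate periodic Navier–Stokes orbit): if `K` is a compact
operator on a real normed space and the contractions `P n` (`‖P n‖ ≤ 1`) converge strongly to the
identity, then `‖P n ∘ K − K‖ → 0` in OPERATOR norm. This feeds the hypothesis `hPK` of the
perturbed bordered inverse-function step (the spatial Galerkin truncations `P_N` applied after the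
compact linearised convection `K = B(x₀,·) + B(·,x₀)`).

The argument is the classical finite `ε`-net one (folklore; e.g. Brezzi–Rappaz–Raviart 1980,
Part I, (3.7)): `K` maps the closed unit ball into a compact, hence totally bounded, set `C`;
pick a finite `ε`-net `t` of `C` and `N₀` with `‖P n y − y‖ < ε` for all `y ∈ t`, `n ≥ N₀`;
for `‖z‖ ≤ 1` choose `y ∈ t` with `‖K z − y‖ < ε`, then
`‖P n (K z) − K z‖ ≤ ‖P n (K z − y)‖ + ‖P n y − y‖ + ‖y − K z‖ < 3ε` since `‖P n‖ ≤ 1`.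

Mathlib only: `IsCompactOperator.image_closedBall_subset_compact`, `IsCompact.totallyBounded`,
`Metric.totallyBounded_iff`, `Set.Finite.eventually_all`,
`ContinuousLinearMap.opNorm_le_of_unit_norm`.
-/

noncomputable section

-- `Summit.<Summit>.<Problem>`: single-conjunct summit, the duplicate namespace is mandated (CONVENTIONS §2).
set_option linter.dupNamespace false

namespace Summit.AnomalousDissipation.AnomalousDissipation.Theorems.UniformWorkFloorTrap.WorkLipschitzCycles

open Filter Topology
open scoped Topology

/-- Pointwise three-`ε` estimate behind `stub_compactTruncationNorm`: if `P` is a contraction,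
`‖P y - y‖ < ε` at a net point `y` with `‖w - y‖ < ε`, then `‖P w - w‖ < 3 * ε`. [folklore] -/
theorem norm_sub_lt_three_mul_of_net {E : Type} [NormedAddCommGroup E] [NormedSpace ℝ E]
    (P : E →L[ℝ] E) (hP : ‖P‖ ≤ 1) {w y : E} {ε : ℝ} (hwy : ‖w - y‖ < ε)
    (hy : ‖P y - y‖ < ε) : ‖P w - w‖ < 3 * ε := by
  have h1 : ‖P (w - y)‖ ≤ ‖w - y‖ :=
    (P.le_opNorm (w - y)).trans (by nlinarith [norm_nonneg (w - y)])
  have h3 : ‖y - w‖ < ε := by rwa [norm_sub_rev]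
  calc ‖P w - w‖ = ‖P (w - y) + (P y - y) + (y - w)‖ := by
        congr 1
        simp only [map_sub]
        abel
    _ ≤ ‖P (w - y)‖ + ‖P y - y‖ + ‖y - w‖ := norm_add₃_le
    _ < ε + ε + ε := by linarith
    _ = 3 * ε := by ring

/-- **S2 · Compact operators upgrade strong to norm convergence** (folklore; e.g.
Brezzi–Rappaz–Raviart 1980, Part I, (3.7)): if `K` is compact and the contractions `P n` converge
strongly to the identity, then `‖P n ∘ K − K‖ → 0` (finite `ε`-net of the totally bounded set
`K(closed unit ball)`, equicontinuity `‖P n‖ ≤ 1`). [folklore] -/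
theorem stub_compactTruncationNorm {E : Type} [NormedAddCommGroup E] [NormedSpace ℝ E]
    (K : E →L[ℝ] E) (hKc : IsCompactOperator K) (P : ℕ → E →L[ℝ] E) (hP : ∀ n, ‖P n‖ ≤ 1)
    (hPs : ∀ y, Tendsto (fun n => P n y) atTop (𝓝 y)) :
    Tendsto (fun n => ‖(P n).comp K - K‖) atTop (𝓝 0) := by
  rw [Metric.tendsto_atTop]
  intro ε hε
  have hε4 : 0 < ε / 4 := by positivity
  -- a compact set containing the image of the closed unit ball
  obtain ⟨C, hC, hKC⟩ := hKc.image_closedBall_subset_compact (f := (K : E →ₗ[ℝ] E)) 1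
  -- a finite `ε / 4`-net of it
  obtain ⟨t, htfin, hCt⟩ := Metric.totallyBounded_iff.1 hC.totallyBounded (ε / 4) hε4
  -- eventually `P n` moves every net point by less than `ε / 4`
  have hev : ∀ᶠ n in atTop, ∀ y ∈ t, dist (P n y) y < ε / 4 :=
    (htfin.eventually_all).2 fun y _ => Metric.tendsto_nhds.1 (hPs y) (ε / 4) hε4
  obtain ⟨N₀, hN₀⟩ := Filter.eventually_atTop.1 hev
  refine ⟨N₀, fun n hn => ?_⟩
  rw [dist_zero_right, norm_norm]
  -- the estimate on the unit sphere
  have hsphere : ∀ z : E, ‖z‖ = 1 → ‖((P n).comp K - K) z‖ ≤ 3 * (ε / 4) := by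
    intro z hz
    have hKz : K z ∈ C :=
      hKC ⟨z, Metric.mem_closedBall.2 (by rw [dist_zero_right, hz]), rfl⟩
    obtain ⟨y, hyt, hy⟩ := Set.mem_iUnion₂.1 (hCt hKz)
    have hwy : ‖K z - y‖ < ε / 4 := by rwa [Metric.mem_ball, dist_eq_norm] at hy
    have hPy : ‖P n y - y‖ < ε / 4 := by
      have := hN₀ n hn y hyt
      rwa [dist_eq_norm] at this
    have h3 := norm_sub_lt_three_mul_of_net (P n) (hP n) hwy hPy
    have heq : ((P n).comp K - K) z = P n (K z) - K z := rfl
    rw [heq]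
    exact h3.le
  calc ‖(P n).comp K - K‖ ≤ 3 * (ε / 4) :=
        ContinuousLinearMap.opNorm_le_of_unit_norm (by positivity) hsphere
    _ < ε := by linarith

end Summit.AnomalousDissipation.AnomalousDissipation.Theorems.UniformWorkFloorTrap.WorkLipschitzCycles

end
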